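import Mathlib
import Summits.NavierStokesRegularity.NavierStokesRegularity.Theorems.BarrierStepRungThreeBarrierSoundnessThree
import Summits.NavierStokesRegularity.NavierStokesRegularity.Theorems.TaoLadderRungThreeRestartControl
import Summits.NavierStokesRegularity.NavierStokesRegularity.Theorems.TaoLadderRungThreeRestartGlue
import Summits.NavierStokesRegularity.NavierStokesRegularity.Theorems.TaoLadderRungThreeLocalDynamicsSufficesAt
import HarnessLib

/-!
# Rung TL-M3 from ONE window certificate in the repaired format K2″ (route `BarrierStepRungThree`)

GLUE for the REPAIRED line (supports item stmt-NavierStokesRegularity-23420 `BarrierCertificate`).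
Prover ns-bsr3-p1 showed that the ∀-crux `BarrierSoundness` (stmt-23421) is misstated as typed (per-shell
outside caps over infinitely many shells with a two-sided tail rate) and PROVED the repaired ∀-side
`Theorems.BarrierSoundness.barrierSoundness₃` (file `BarrierStepRungThreeBarrierSoundnessThree.lean`):
every barrier/clock certificate with ONE-DIRECTIONAL tail bookkeeping (tail sums above the window with the
recursion `2^{5(k-1)/2}(∑|α_{·,(0,0,1)}|) q_{k-1}² ≤ ρ_k`, base link `2Φ_{i,n-1} ≤ q_{kLo+n-1}²`, re-entry
decay `q_{k+1} ≤ 2^{-θ} r_k`, per-coordinate caps `Φ i j` and properness bounds `Mw i j`; per-shell caps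
and TAIL RATE only below the window) is SOUND: the description `P′` holds at the datum and
`RobustStep 1 θ c η i₀ α P′ env`.

This file closes the loop for that format, OUTSIDE the cone of the route file (it imports only the
route-independent support theorems `RestartControl.main`, `RestartGlue.epochCheckpoints_succ`,
`LocalDynamicsSufficesAt.noGlobalCascade_of_local` of the host rung): the hypotheses of
`barrierSoundness₃` for given data already give `NoGlobalCascade 1 α X₀` for THAT table and datum
(`noGlobalCascade_of_certificate₃`), and, existentially quantified over all data (`Certificate″`, the
recommended re-typing of the ∃-crux `BarrierCertificate`), the rung leaf `TaoLadderRungThree.Target`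
(`taoLadderRungThree_target_of_certificate₃`) — exactly the plumbing of the route's deciding theorem
`Theses.BarrierStepRungThree.closes` with `P′` in the description slot. So, in the repaired format, the
whole line reduces to producing ONE certificate (a finite list of pointwise polynomial / norm inequalities
for some comparable table); the planner's re-typing of items 23420/23421 is a binder list.

HONEST FRAMING: implications about Tao-type MODEL lattice pseudo-flows at the dyadic scale ratio
(Tao 2016 §6); the hypothesis — a certificate for SOME comparable table — is NOT proved here and is the
line's open ∃-crux; the conclusion is the class rung TL-M3 (`TaoLadderRungThree.Target`), not the summit
Statement. Nothing in this file is a statement about the Navier–Stokes equations; NS regularity is not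
proved by any of this.
-/

noncomputable section

-- the sub-problem namespace `Summit.NavierStokesRegularity.NavierStokesRegularity` repeats the summit name by design (D-0017)
set_option linter.dupNamespace false

namespace Summit.NavierStokesRegularity.NavierStokesRegularity.Theorems

open Literature.Analysis.FluidPDE Literature.Analysis.FluidPDE.TaoCascade

/-- **No global cascade for a table carrying a window certificate in the repaired format K2″.** If the
data `(R, θ, c, η, γ, i₀, α, X₀, n, kLo, v, g, r, q, ρ, env, Ψ, Mw, Φ, win, vf)` satisfy the clauses of
the repaired barrier/clock certificate — VERBATIM the hypotheses of
`Theorems.BarrierSoundness.barrierSoundness₃` (comparable table, one-shell datum, window `[kLo, kLo+n)`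
containing shells `0, 1`, `C¹` clock `v`, continuous goal `g`, outside profile `r < q` with rate `ρ` and the
one-directional recursion above the window, envelopes, per-coordinate caps/properness, datum clauses,
clock floor, ROBUST decrease `⟨∇v(win S), quadTerm(S)|window + d⟩ ≤ -γ` on the region, tail rate below
the window, goal ⇒ rescaled re-entry) — then the table `α` with datum `X₀` has no global
Theorem-4.2-level pseudo-solution at the dyadic end: `NoGlobalCascade 1 α X₀`.
PROOF: `barrierSoundness₃` gives `P′(datum)` and `RobustStep 1 θ c η i₀ α P′ env`;
`RestartControl.main` (restarted flows of a pseudo-solution at a checkpoint are `(η,η)`-pseudo-flows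
with admissible slack for `n₀ ≥ N₀(K₁,K₂)`) feeds the step, `RestartGlue.epochCheckpoints_succ` extends
the checkpoint chain, and `LocalDynamicsSufficesAt.noGlobalCascade_of_local` concludes.
[cite: Tao2016AveragedNS, §6.4 Prop. 6.5 with §6.2 Thm. 6.2; doi:10.1137/050645178 Thm 3.5 and §3.4] -/
theorem noGlobalCascade_of_certificate₃ {R θ c η γ : ℝ} {i₀ : Fin 4} {α : Fin 4 → Fin 4 → Fin 4 → ℤ × ℤ × ℤ → ℝ} {X₀ : Fin 4 → ℝ} {n : ℕ} {kLo : ℤ} {v g : (Fin 4 → Fin n → ℝ) → ℝ} {r q ρ env Ψ : ℤ → ℝ} {Mw Φ : Fin 4 → Fin n → ℝ} {win : (Fin 4 → ℤ → ℝ) → (Fin 4 → Fin n → ℝ)} {vf : (Fin 4 → ℤ → ℝ) → (Fin 4 → ℤ → ℝ)}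
    (hcond : 1 ≤ R ∧ Literature.Analysis.FluidPDE.TaoCascade.InTableClass R α ∧ X₀ i₀ ≠ 0 ∧ 0 ≤ θ ∧ θ ≤ 1 / 2 ∧ 0 < c ∧ 0 < η ∧ 0 < γ ∧ kLo ≤ 0 ∧ (2 : ℤ) ≤ kLo + n ∧ (∀ (S : Fin 4 → ℤ → ℝ) (i : Fin 4) (j : Fin n), win S i j = S i (kLo + (j : ℕ))) ∧ (∀ (S : Fin 4 → ℤ → ℝ) (i : Fin 4) (k : ℤ), vf S i k = Literature.Analysis.FluidPDE.TaoCascade.quadTerm 1 α (fun i' k' (_ : ℝ) => S i' k') i k 0) ∧ ContDiff ℝ 1 v ∧ Continuous g ∧ (∀ (L' : ℕ) (k : ℤ), Literature.Analysis.FluidPDE.TaoCascade.slackWeight 1 θ c env L' k ≤ Ψ k) ∧ (∀ k : ℤ, 0 ≤ r k ∧ r k < q k ∧ 0 ≤ ρ k ∧ r k + c * ρ k ≤ q k ∧ q k ^ 2 / 2 ≤ env k) ∧ (∀ k : ℤ, kLo + n ≤ k → (1 + 1 : ℝ) ^ ((5 : ℝ) * ((k - 1 : ℤ) : ℝ) /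 2) * (∑ i₁ : Fin 4, ∑ i₂ : Fin 4, ∑ i₃ : Fin 4, |α i₁ i₂ i₃ (0, 0, 1)|) * q (k - 1) ^ 2 ≤ ρ k) ∧ (∀ (i : Fin 4) (j : Fin n), (j : ℕ) + 1 = n → 2 * Φ i j ≤ q (kLo + (j : ℕ)) ^ 2) ∧ (∀ k : ℤ, kLo + n ≤ k → q (k + 1) ≤ (1 + 1 : ℝ) ^ (-θ) * r k) ∧ (∀ (i : Fin 4) (j : Fin n), 0 ≤ Φ i j ∧ Φ i j ≤ env (kLo + (j : ℕ)) ∧ Mw i j ^ 2 / 2 + η * Ψ (kLo + (j : ℕ)) + η * (1 + 1 : ℝ) ^ ((2 : ℝ) * ((kLo + (j : ℕ) : ℤ) : ℝ)) * c * Φ i j < Φ i j) ∧ (∃ M₁ : ℝ, ∀ k : ℤ, kLo + n ≤ k → (1 + (1 + 1 : ℝ) ^ ((10 : ℝ) * (k : ℝ))) * q k ≤ M₁) ∧ v (win (Literature.Analysis.FluidPDE.TaoCascade.datumState i₀ X₀)) ≤ 0 ∧ 0 < g (win (Literature.Analysis.FluidPDE.TaoCascade.datumState i₀ X₀)) ∧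 (∀ x : Fin 4 → Fin n → ℝ, v x ≤ 0 → ∀ i j, |x i j| ≤ Mw i j) ∧ (∀ x : Fin 4 → Fin n → ℝ, v x ≤ 0 → 0 < g x → -(γ * c) < v x) ∧ (∀ (S F : Fin 4 → ℤ → ℝ) (d : Fin 4 → Fin n → ℝ), (v (win S) ≤ 0 ∧ (∀ i k, S i k ^ 2 ≤ 2 * F i k) ∧ (∀ i k, 0 ≤ F i k) ∧ (∀ i k, (k < kLo ∨ kLo + n ≤ k) → F i k ≤ q k ^ 2 / 2) ∧ (∀ (i : Fin 4) (j : Fin n), F i (kLo + (j : ℕ)) ≤ Φ i j)) → 0 < g (win S) → (∀ (i : Fin 4) (j : Fin n), |d i j| ≤ η * (1 + 1 : ℝ) ^ ((2 : ℝ) * ((kLo + (j : ℕ) : ℤ) : ℝ)) * Real.sqrt (Φ i j)) → (fderiv ℝ v (win S)) (fun i j => vf S i (kLo + (j : ℕ)) + d i j) ≤ -γ) ∧ (∀ (S F : Fin 4 → ℤ → ℝ), (v (win S) ≤ 0 ∧ (∀ i k, S i k ^ 2 ≤ 2 * F i k) ∧ (∀ i k, 0 ≤ F i k) ∧ (∀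 i k, (k < kLo ∨ kLo + n ≤ k) → F i k ≤ q k ^ 2 / 2) ∧ (∀ (i : Fin 4) (j : Fin n), F i (kLo + (j : ℕ)) ≤ Φ i j)) → ∀ (i : Fin 4) (k : ℤ), k < kLo → vf S i k * S i k ≤ ρ k * |S i k|) ∧ (∀ (S F : Fin 4 → ℤ → ℝ), (v (win S) ≤ 0 ∧ (∀ i k, S i k ^ 2 ≤ 2 * F i k) ∧ (∀ i k, 0 ≤ F i k) ∧ (∀ i k, (k < kLo ∨ kLo + n ≤ k) → F i k ≤ q k ^ 2 / 2) ∧ (∀ (i : Fin 4) (j : Fin n), F i (kLo + (j : ℕ)) ≤ Φ i j)) → g (win S) ≤ 0 → (1 + 1 : ℝ) ^ (-θ) ≤ |S i₀ 1| ∧ v (win (fun i k => S i (1 + k) / |S i₀ 1|)) ≤ 0 ∧ 0 < g (win (fun i k => S i (1 + k) / |S i₀ 1|)) ∧ (∀ i k, k < kLo → F i (1 + k) / |S i₀ 1| ^ 2 ≤ r k ^ 2 / 2))) :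
    Literature.Analysis.FluidPDE.TaoCascade.NoGlobalCascade 1 α X₀ := by
  obtain ⟨hP, hstep⟩ :=
    BarrierSoundness.barrierSoundness₃ R θ c η γ i₀ α X₀ n kLo v g r q ρ env Ψ Mw Φ win vf hcond
  obtain ⟨-, -, hX₀, -, hθ, hc, hη, -⟩ := hcond
  -- work at a general scale ratio `ε₀ > 0`; specialise to the dyadic `ε₀ = 1` at the end
  obtain ⟨ε₀, hε₀, hε₁⟩ : ∃ ε₀ : ℝ, 0 < ε₀ ∧ ε₀ = 1 := ⟨1, one_pos, rfl⟩
  rw [← hε₁] at hstep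
  have hng : Literature.Analysis.FluidPDE.TaoCascade.NoGlobalCascade ε₀ α X₀ := by
    refine LocalDynamicsSufficesAt.noGlobalCascade_of_local (θ := θ) (c := c) (i₀ := i₀)
      (P := (fun S F => v (win S) ≤ 0 ∧ 0 < g (win S) ∧ (∀ i k, 0 ≤ F i k) ∧
        (∀ i k, k < kLo → F i k ≤ r k ^ 2 / 2) ∧
        (∀ k : ℤ, kLo + n ≤ k → ∀ L : ℕ, ∑ j ∈ Finset.range L, ∑ i, F i (k + j) ≤ r k ^ 2 / 2) ∧
        (∃ D : ℕ, ∀ i k, k + D < kLo → S i k = 0 ∧ F i k = 0) ∧ ∃ B : ℝ, ∀ i k, F i k ≤ B))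
      (Q := Literature.Analysis.FluidPDE.TaoCascade.epochEnvelope env) hε₀ (by linarith) hc hX₀ hP ?_
    intro K₁ K₂ hK₁ hK₂
    obtain ⟨N₀, hN₀⟩ := RestartControl.main (ε₀ := ε₀) (α := α) (env := env)
      (P := (fun S F => v (win S) ≤ 0 ∧ 0 < g (win S) ∧ (∀ i k, 0 ≤ F i k) ∧
        (∀ i k, k < kLo → F i k ≤ r k ^ 2 / 2) ∧
        (∀ k : ℤ, kLo + n ≤ k → ∀ L : ℕ, ∑ j ∈ Finset.range L, ∑ i, F i (k + j) ≤ r k ^ 2 / 2) ∧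
        (∃ D : ℕ, ∀ i k, k + D < kLo → S i k = 0 ∧ F i k = 0) ∧ ∃ B : ℝ, ∀ i k, F i k ≤ B))
      hε₀ hθ hc.le hη hX₀ hK₁ hK₂
    refine ⟨N₀, fun n₀ hn₀ T hT X E hsol N hN t e hcp hhor => ?_⟩
    have heN : 0 < e N := hcp.e_pos N hN le_rfl
    have hpow : 0 < (1 + ε₀) ^ ((5 : ℝ) * N / 2) := Real.rpow_pos_of_pos (by linarith) _
    have hγ : 0 < e N * (1 + ε₀) ^ ((5 : ℝ) * N / 2) := mul_pos heN hpow
    have hneg : (1 + ε₀) ^ (-(5 : ℝ) * N / 2) = ((1 + ε₀) ^ ((5 : ℝ) * N / 2))⁻¹ := by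
      rw [← Real.rpow_neg (by linarith : (0 : ℝ) ≤ 1 + ε₀)]
      congr 1
      ring
    have hcγ : c * (1 + ε₀) ^ (-(5 : ℝ) * N / 2) * (e N)⁻¹ =
        c / (e N * (1 + ε₀) ^ ((5 : ℝ) * N / 2)) := by
      rw [hneg]
      field_simp
    rw [hcγ] at hhor
    have htN : t N < T := by
      have hdiv : 0 < c / (e N * (1 + ε₀) ^ ((5 : ℝ) * N / 2)) := div_pos hc hγ
      linarith
    have hτ : c ≤ (T - t N) * (e N * (1 + ε₀) ^ ((5 : ℝ) * N / 2)) := by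
      have h2 : c / (e N * (1 + ε₀) ^ ((5 : ℝ) * N / 2)) ≤ T - t N := by linarith
      have h3 := mul_le_mul_of_nonneg_right h2 hγ.le
      rwa [div_mul_cancel₀ c hγ.ne'] at h3
    obtain ⟨hflow, hslack⟩ := hN₀ n₀ hn₀ T hT X E hsol N hN t e hcp htN
    obtain ⟨τ₁, a, hst⟩ :=
      hstep (N - n₀).toNat _ _ _ (hcp.state N hN le_rfl) hslack _ hτ _ _ hflow
    exact ⟨_, _, RestartGlue.epochCheckpoints_succ hε₀ hN hcp hst⟩
  rw [hε₁] at hng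
  exact hng

/-- **Rung TL-M3 from a window certificate in the repaired format K2″** (`Certificate″ → Target`, the
recommended re-typing of the pair `BarrierCertificate`/`BarrierSoundness` made into one implication).
If SOME data satisfy the clauses of the repaired barrier/clock certificate (verbatim the hypotheses of
`Theorems.BarrierSoundness.barrierSoundness₃`), then some `R`-comparable table has no global
Theorem-4.2-level pseudo-solution at the dyadic end: `TaoLadderRungThree.Target`. Immediate from
`noGlobalCascade_of_certificate₃` (the certificate's own table and datum are the witnesses).
[cite: Tao2016AveragedNS, §6.4 Prop. 6.5 with §6.1–6.2; doi:10.1137/050645178 Thm 3.5 and §3.4] -/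
theorem taoLadderRungThree_target_of_certificate₃
    (hcert : ∃ (R θ c η γ : ℝ) (i₀ : Fin 4) (α : Fin 4 → Fin 4 → Fin 4 → ℤ × ℤ × ℤ → ℝ) (X₀ : Fin 4 → ℝ) (n : ℕ) (kLo : ℤ) (v g : (Fin 4 → Fin n → ℝ) → ℝ) (r q ρ env Ψ : ℤ → ℝ) (Mw Φ : Fin 4 → Fin n → ℝ) (win : (Fin 4 → ℤ → ℝ) → (Fin 4 → Fin n → ℝ)) (vf : (Fin 4 → ℤ → ℝ) → (Fin 4 → ℤ → ℝ)), 1 ≤ R ∧ Literature.Analysis.FluidPDE.TaoCascade.InTableClass R α ∧ X₀ i₀ ≠ 0 ∧ 0 ≤ θ ∧ θ ≤ 1 / 2 ∧ 0 < c ∧ 0 < η ∧ 0 < γ ∧ kLo ≤ 0 ∧ (2 : ℤ) ≤ kLo + n ∧ (∀ (S : Fin 4 → ℤ → ℝ) (i : Fin 4) (j : Fin n), win S i j = S i (kLo + (j : ℕ))) ∧ (∀ (S : Fin 4 → ℤ → ℝ) (i : Fin 4) (k : ℤ), vf S i k = Literature.Analysis.FluidPDE.TaoCascade.quadTerm 1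 α (fun i' k' (_ : ℝ) => S i' k') i k 0) ∧ ContDiff ℝ 1 v ∧ Continuous g ∧ (∀ (L' : ℕ) (k : ℤ), Literature.Analysis.FluidPDE.TaoCascade.slackWeight 1 θ c env L' k ≤ Ψ k) ∧ (∀ k : ℤ, 0 ≤ r k ∧ r k < q k ∧ 0 ≤ ρ k ∧ r k + c * ρ k ≤ q k ∧ q k ^ 2 / 2 ≤ env k) ∧ (∀ k : ℤ, kLo + n ≤ k → (1 + 1 : ℝ) ^ ((5 : ℝ) * ((k - 1 : ℤ) : ℝ) / 2) * (∑ i₁ : Fin 4, ∑ i₂ : Fin 4, ∑ i₃ : Fin 4, |α i₁ i₂ i₃ (0, 0, 1)|) * q (k - 1) ^ 2 ≤ ρ k) ∧ (∀ (i : Fin 4) (j : Fin n), (j : ℕ) + 1 = n → 2 * Φ i j ≤ q (kLo + (j : ℕ)) ^ 2) ∧ (∀ k : ℤ, kLo + n ≤ k → q (k + 1) ≤ (1 + 1 : ℝ) ^ (-θ) * r k) ∧ (∀ (i : Fin 4) (j : Fin n), 0 ≤ Φ i j ∧ Φ i j ≤ env (kLo + (j : ℕ)) ∧ Mw i j ^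 2 / 2 + η * Ψ (kLo + (j : ℕ)) + η * (1 + 1 : ℝ) ^ ((2 : ℝ) * ((kLo + (j : ℕ) : ℤ) : ℝ)) * c * Φ i j < Φ i j) ∧ (∃ M₁ : ℝ, ∀ k : ℤ, kLo + n ≤ k → (1 + (1 + 1 : ℝ) ^ ((10 : ℝ) * (k : ℝ))) * q k ≤ M₁) ∧ v (win (Literature.Analysis.FluidPDE.TaoCascade.datumState i₀ X₀)) ≤ 0 ∧ 0 < g (win (Literature.Analysis.FluidPDE.TaoCascade.datumState i₀ X₀)) ∧ (∀ x : Fin 4 → Fin n → ℝ, v x ≤ 0 → ∀ i j, |x i j| ≤ Mw i j) ∧ (∀ x : Fin 4 → Fin n → ℝ, v x ≤ 0 → 0 < g x → -(γ * c) < v x) ∧ (∀ (S F : Fin 4 → ℤ → ℝ) (d : Fin 4 → Fin n → ℝ), (v (win S) ≤ 0 ∧ (∀ i k, S i k ^ 2 ≤ 2 * F i k) ∧ (∀ i k, 0 ≤ F i k) ∧ (∀ i k, (k < kLo ∨ kLo + n ≤ k) → F i k ≤ q k ^ 2 / 2) ∧ (∀ (i : Fin 4) (j : Fin n), F i (kLo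 + (j : ℕ)) ≤ Φ i j)) → 0 < g (win S) → (∀ (i : Fin 4) (j : Fin n), |d i j| ≤ η * (1 + 1 : ℝ) ^ ((2 : ℝ) * ((kLo + (j : ℕ) : ℤ) : ℝ)) * Real.sqrt (Φ i j)) → (fderiv ℝ v (win S)) (fun i j => vf S i (kLo + (j : ℕ)) + d i j) ≤ -γ) ∧ (∀ (S F : Fin 4 → ℤ → ℝ), (v (win S) ≤ 0 ∧ (∀ i k, S i k ^ 2 ≤ 2 * F i k) ∧ (∀ i k, 0 ≤ F i k) ∧ (∀ i k, (k < kLo ∨ kLo + n ≤ k) → F i k ≤ q k ^ 2 / 2) ∧ (∀ (i : Fin 4) (j : Fin n), F i (kLo + (j : ℕ)) ≤ Φ i j)) → ∀ (i : Fin 4) (k : ℤ), k < kLo → vf S i k * S i k ≤ ρ k * |S i k|) ∧ (∀ (S F : Fin 4 → ℤ → ℝ), (v (win S) ≤ 0 ∧ (∀ i k, S i k ^ 2 ≤ 2 * F i k) ∧ (∀ i k, 0 ≤ F i k) ∧ (∀ i k, (k < kLo ∨ kLo + n ≤ k) → F i k ≤ q k ^ 2 / 2) ∧ (∀ (i : Fin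 4) (j : Fin n), F i (kLo + (j : ℕ)) ≤ Φ i j)) → g (win S) ≤ 0 → (1 + 1 : ℝ) ^ (-θ) ≤ |S i₀ 1| ∧ v (win (fun i k => S i (1 + k) / |S i₀ 1|)) ≤ 0 ∧ 0 < g (win (fun i k => S i (1 + k) / |S i₀ 1|)) ∧ (∀ i k, k < kLo → F i (1 + k) / |S i₀ 1| ^ 2 ≤ r k ^ 2 / 2))) :
    Summit.NavierStokesRegularity.NavierStokesRegularity.Theses.TaoLadderRungThree.Target := by
  obtain ⟨R, θ, c, η, γ, i₀, α, X₀, n, kLo, v, g, r, q, ρ, env, Ψ, Mw, Φ, win, vf, hcond⟩ := hcert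
  exact ⟨R, hcond.1, α, X₀, hcond.2.1, noGlobalCascade_of_certificate₃ hcond⟩

end Summit.NavierStokesRegularity.NavierStokesRegularity.Theorems

end
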